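import Mathlib
import HarnessLib
import Summits.Ventures.LatticeQCDFlow.Scaling.TorusPlaquetteLastLinks

/-!
# LatticeQCDFlow / Scaling — exact plaquette covers of `(ℤ/L)^d` and generation orders that close
# plaquettes at exactly `#plaquettes/(2(d−1)) = d·#sites/4` links

HONEST FRAMING: exact (Metropolis-corrected) sampling algorithms for lattice gauge theory;
figures of merit are autocorrelation/cost numbers at stated couplings and volumes; no
continuum-physics claim.

Venture `LatticeQCDFlow` (cell pub-lqcd), topic `Scaling`, FANOUT row 30 (lean-1, GEN-23) — OUR WORK on
THEORY-2.md §4 row C5 (autoregressive context), the COUNTING step of the volume law.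
`Scaling/TorusPlaquetteLastLinks` proves that in EVERY generation order of all links of `(ℤ/L)^d` the
last links of the plaquettes form a set `T` with `#plaquettes ≤ 2(d−1)·#T`, i.e. `#T ≥ d·#sites/4`, and
the volume laws of `Scaling/AutoregressiveGaugeKLExtensiveAllPlanes…` charge their per-link floor once
per element of `T`.  When is that bound an equality?  This file isolates the mechanism; the companion
`Scaling/TorusPlaquetteCoverParity` exhibits it in `d = 2, 3, 4`.

Call a set `C` of links an EXACT PLAQUETTE COVER if every plaquette has exactly one of its four links in
`C`.  Generating the links outside `C` first (in any order) and the links of `C` last, no plaquette is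
closed in the first phase and each link of `C` closes ALL `2(d−1)` plaquettes through it: the last links
are exactly the links of `C`, and double counting gives `#C·2(d−1) = #plaquettes`, i.e. `4·#C = d·#sites`
— the lower bound of `exists_lastLinks_all` attained.

## What is proved (all [ours] unless marked)

* §1 **`le_card_filter_mem_plaquetteLinks`**, **`card_filter_mem_plaquetteLinks_eq`** — for `L ≥ 2`,
  `d ≥ 2` a link lies on EXACTLY `2(d−1)` plaquettes (the tree had `≤`). [folklore]
* §2 **`exists_order_of_plaquetteCover`** — an exact plaquette cover `C` yields a duplicate-free list of
  all links along which every plaquette's `C`-link comes strictly after its three other links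
  (by `List.idxOf`), i.e. is its last link.
* §3 **`card_mul_eq_card_plaquette_of_cover`**, **`four_mul_card_eq_of_cover`** — for an exact cover,
  `#C·2(d−1) = #plaquettes` and `4·#C = d·#sites` (double counting).
* §4 **`exists_sharp_order_of_cover`** — the three combined: cover ⇒ an order whose plaquette last
  links form a set of exactly `d·#sites/4` links.

Pure lattice combinatorics; no measure theory.  No `def`, no `sorry`, nothing cited as a fact.
-/

namespace Summit.Ventures.LatticeQCDFlow.Theory2.Autoregressive

open Literature.MathematicalPhysics.QuantumFieldTheory

/-! ## §1 A link lies on exactly `2(d−1)` plaquettes -/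

/-- **A link lies on at least `2(d−1)` plaquettes** (`d ≥ 2`, `L ≥ 2`): for `ν ≠ μ` the two plaquettes in
the `{μ, ν}` plane based at `y` and at `y − e_ν` both have `(y, μ)` among their four links, and these
`2(d−1)` plaquettes are distinct.  With `card_filter_mem_plaquetteLinks_le` the count is exact. [folklore] -/
theorem le_card_filter_mem_plaquetteLinks {d L : ℕ} [NeZero L] (hd : 2 ≤ d) (hL : 2 ≤ L) (e : Edge d L) :
    2 * (d - 1) ≤ ((Finset.univ : Finset (Plaquette d L)).filter (fun p => e ∈
      ({(p.1, p.2.1.1), (p.1.shift p.2.1.1, p.2.1.2), (p.1.shift p.2.1.2, p.2.1.1), (p.1, p.2.1.2)} :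
        Finset (Edge d L)))).card := by
  classical
  haveI : Fact (1 < L) := ⟨hL⟩
  obtain ⟨y, μ⟩ := e
  have h01 : (⟨0, by omega⟩ : Fin d) < ⟨1, by omega⟩ := by rw [Fin.lt_def]; norm_num
  set pl : Fin d → {q : Fin d × Fin d // q.1 < q.2} := fun ν =>
    if h : μ < ν then ⟨(μ, ν), h⟩ else if h' : ν < μ then ⟨(ν, μ), h'⟩ else ⟨(⟨0, by omega⟩, ⟨1, by omega⟩), h01⟩
    with hpl
  set g : Fin d × Bool → Plaquette d L := fun q =>
    (if q.2 then y - Pi.single q.1 1 else y, pl q.1) with hg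
  set s : Finset (Fin d × Bool) := (Finset.univ.erase μ) ×ˢ Finset.univ with hs
  have hscard : s.card = 2 * (d - 1) := by
    rw [hs, Finset.card_product, Finset.card_erase_of_mem (Finset.mem_univ _), Finset.card_univ,
      Fintype.card_fin, Finset.card_univ, Fintype.card_bool]; ring
  rw [← hscard]
  refine Finset.card_le_card_of_injOn g (fun q hq => ?_) (fun q hq q' hq' hqq => ?_)
  · rw [Finset.mem_coe, hs, Finset.mem_product, Finset.mem_erase] at hq
    have hne : q.1 ≠ μ := hq.1.1
    rw [Finset.mem_coe, Finset.mem_filter]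
    refine ⟨Finset.mem_univ _, ?_⟩
    simp only [Finset.mem_insert, Finset.mem_singleton]
    obtain ⟨ν, b⟩ := q
    simp only at hne ⊢
    by_cases hlt : μ < ν
    · have hplν : pl ν = ⟨(μ, ν), hlt⟩ := by simp [hpl, hlt]
      cases b
      · left; simp [hg, hplν]
      · right; right; left; simp [hg, hplν, Site.shift]
    · have hgt : ν < μ := lt_of_le_of_ne (not_lt.1 hlt) hne
      have hplν : pl ν = ⟨(ν, μ), hgt⟩ := by simp [hpl, hlt, hgt]
      cases b
      · right; right; right; simp [hg, hplν]
      · right; left; simp [hg, hplν, Site.shift]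
  · rw [Finset.mem_coe, hs, Finset.mem_product, Finset.mem_erase] at hq hq'
    obtain ⟨ν, b⟩ := q
    obtain ⟨ν', b'⟩ := q'
    have hne : ν ≠ μ := hq.1.1
    have hne' : ν' ≠ μ := hq'.1.1
    have hplane : pl ν = pl ν' := congrArg Prod.snd hqq
    have hsite : (if b then y - Pi.single ν 1 else y) = (if b' then y - Pi.single ν' 1 else y) :=
      congrArg Prod.fst hqq
    have hνν : ν = ν' := by
      have key : ∀ a : Fin d, a ≠ μ → ((pl a).1.1 = a ∨ (pl a).1.2 = a) ∧ ((pl a).1.1 = μ ∨ (pl a).1.2 = μ) := by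
        intro a ha
        by_cases hlt : μ < a
        · simp [hpl, hlt]
        · have hgt : a < μ := lt_of_le_of_ne (not_lt.1 hlt) ha
          simp [hpl, hlt, hgt]
      have hlt12 : (pl ν).1.1 < (pl ν).1.2 := (pl ν).2
      obtain ⟨h1, h2⟩ := key ν hne
      obtain ⟨h1', h2'⟩ := key ν' hne'
      rw [← hplane] at h1' h2'
      rcases h1 with h1 | h1 <;> rcases h1' with h1' | h1'
      · exact h1.symm.trans h1'
      · exfalso
        rcases h2 with h2 | h2
        · exact hne (h1.symm.trans h2)
        · exact hne' (h1'.symm.trans h2)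
      · exfalso
        rcases h2 with h2 | h2
        · exact hne' (h1'.symm.trans h2)
        · exact hne (h1.symm.trans h2)
      · exact h1.symm.trans h1'
    subst hνν
    have hsingle : (Pi.single ν (1 : ZMod L) : Site d L) ≠ 0 := by
      intro h
      have := congrFun h ν
      simp at this
    cases b <;> cases b'
    · rfl
    · exfalso; simp only [Bool.false_eq_true, ↓reduceIte] at hsite
      exact hsingle (sub_eq_self.1 hsite.symm)
    · exfalso; simp only [Bool.false_eq_true, ↓reduceIte] at hsite
      exact hsingle (sub_eq_self.1 hsite)
    · rfl

/-- **A link lies on exactly `2(d−1)` plaquettes** (`d ≥ 2`, `L ≥ 2`). [folklore] -/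
theorem card_filter_mem_plaquetteLinks_eq {d L : ℕ} [NeZero L] (hd : 2 ≤ d) (hL : 2 ≤ L) (e : Edge d L) :
    ((Finset.univ : Finset (Plaquette d L)).filter (fun p => e ∈
      ({(p.1, p.2.1.1), (p.1.shift p.2.1.1, p.2.1.2), (p.1.shift p.2.1.2, p.2.1.1), (p.1, p.2.1.2)} :
        Finset (Edge d L)))).card = 2 * (d - 1) :=
  le_antisymm (card_filter_mem_plaquetteLinks_le e) (le_card_filter_mem_plaquetteLinks hd hL e)

/-! ## §2 An exact plaquette cover yields an order whose last links are the cover -/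

/-- **Cover ⇒ order.**  If every plaquette has exactly one of its four links in `C`, then listing the
links outside `C` first and the links of `C` last gives a duplicate-free list of ALL links along which,
for every plaquette, the `C`-link comes strictly after the three other links (by `List.idxOf`). [ours] -/
theorem exists_order_of_plaquetteCover {d L : ℕ} [NeZero L] (C : Finset (Edge d L))
    (hC : ∀ p : Plaquette d L, ∃ e ∈ ({(p.1, p.2.1.1), (p.1.shift p.2.1.1, p.2.1.2),
        (p.1.shift p.2.1.2, p.2.1.1), (p.1, p.2.1.2)} : Finset (Edge d L)),
      e ∈ C ∧ ∀ e' ∈ ({(p.1, p.2.1.1), (p.1.shift p.2.1.1, p.2.1.2),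
        (p.1.shift p.2.1.2, p.2.1.1), (p.1, p.2.1.2)} : Finset (Edge d L)), e' ≠ e → e' ∉ C) :
    ∃ l : List (Edge d L), l.Nodup ∧ (∀ e : Edge d L, e ∈ l) ∧
      ∀ p : Plaquette d L, ∃ e ∈ ({(p.1, p.2.1.1), (p.1.shift p.2.1.1, p.2.1.2),
          (p.1.shift p.2.1.2, p.2.1.1), (p.1, p.2.1.2)} : Finset (Edge d L)),
        e ∈ C ∧ ∀ e' ∈ ({(p.1, p.2.1.1), (p.1.shift p.2.1.1, p.2.1.2),
          (p.1.shift p.2.1.2, p.2.1.1), (p.1, p.2.1.2)} : Finset (Edge d L)), e' ≠ e → l.idxOf e' < l.idxOf e := by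
  classical
  set l₁ : List (Edge d L) := (Finset.univ \ C).toList with hl₁
  set l₂ : List (Edge d L) := C.toList with hl₂
  have hmem₁ : ∀ e, e ∈ l₁ ↔ e ∉ C := fun e => by simp [hl₁]
  have hmem₂ : ∀ e, e ∈ l₂ ↔ e ∈ C := fun e => by simp [hl₂]
  refine ⟨l₁ ++ l₂, ?_, fun e => ?_, fun p => ?_⟩
  · refine List.nodup_append'.2 ⟨Finset.nodup_toList _, Finset.nodup_toList _, ?_⟩
    exact List.disjoint_left.2 fun e h1 h2 => (hmem₁ e).1 h1 ((hmem₂ e).1 h2)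
  · by_cases he : e ∈ C
    · exact List.mem_append_right _ ((hmem₂ e).2 he)
    · exact List.mem_append_left _ ((hmem₁ e).2 he)
  · obtain ⟨e, hel, heC, hothers⟩ := hC p
    refine ⟨e, hel, heC, fun e' he' hne => ?_⟩
    have he'C : e' ∉ C := hothers e' he' hne
    have h1 : e' ∈ l₁ := (hmem₁ e').2 he'C
    have h2 : e ∉ l₁ := fun h => (hmem₁ e).1 h heC
    rw [List.idxOf_append_of_mem h1, List.idxOf_append_of_notMem h2]
    exact lt_of_lt_of_le (List.idxOf_lt_length_of_mem h1) (Nat.le_add_right _ _)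

/-! ## §3 Double counting: an exact cover has exactly `#plaquettes/(2(d−1))` links -/

/-- **Double counting for an exact plaquette cover** (`d ≥ 2`, `L ≥ 2`): every link of `C` lies on exactly
`2(d−1)` plaquettes and every plaquette has exactly one link in `C`, so `#C·2(d−1) = #plaquettes`. [ours] -/
theorem card_mul_eq_card_plaquette_of_cover {d L : ℕ} [NeZero L] (hd : 2 ≤ d) (hL : 2 ≤ L)
    (C : Finset (Edge d L))
    (hC : ∀ p : Plaquette d L, ∃ e ∈ ({(p.1, p.2.1.1), (p.1.shift p.2.1.1, p.2.1.2),
        (p.1.shift p.2.1.2, p.2.1.1), (p.1, p.2.1.2)} : Finset (Edge d L)),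
      e ∈ C ∧ ∀ e' ∈ ({(p.1, p.2.1.1), (p.1.shift p.2.1.1, p.2.1.2),
        (p.1.shift p.2.1.2, p.2.1.1), (p.1, p.2.1.2)} : Finset (Edge d L)), e' ≠ e → e' ∉ C) :
    C.card * (2 * (d - 1)) = Fintype.card (Plaquette d L) := by
  classical
  set lk : Plaquette d L → Finset (Edge d L) := fun p =>
    {(p.1, p.2.1.1), (p.1.shift p.2.1.1, p.2.1.2), (p.1.shift p.2.1.2, p.2.1.1), (p.1, p.2.1.2)} with hlk
  set r : Edge d L → Plaquette d L → Prop := fun e p => e ∈ lk p with hr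
  have hm : ∀ e ∈ C, ((Finset.univ : Finset (Plaquette d L)).bipartiteAbove r e).card = 2 * (d - 1) := by
    intro e _
    have h1 : (Finset.univ : Finset (Plaquette d L)).bipartiteAbove r e =
        Finset.univ.filter (fun p => e ∈ lk p) := by
      ext p; simp [Finset.mem_bipartiteAbove, hr]
    rw [h1]
    exact card_filter_mem_plaquetteLinks_eq hd hL e
  have hn : ∀ p ∈ (Finset.univ : Finset (Plaquette d L)), (C.bipartiteBelow r p).card = 1 := by
    intro p _
    obtain ⟨e, hel, heC, hothers⟩ := hC p
    have h1 : C.bipartiteBelow r p = {e} := by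
      ext e'
      simp only [Finset.mem_bipartiteBelow, Finset.mem_singleton, hr]
      constructor
      · rintro ⟨he'C, he'l⟩
        by_contra hne
        exact hothers e' he'l hne he'C
      · rintro rfl
        exact ⟨heC, hel⟩
    rw [h1, Finset.card_singleton]
  have h := Finset.card_mul_eq_card_mul r hm hn
  rwa [Finset.card_univ, mul_one] at h

/-- **`4·#C = d·#sites`** for an exact plaquette cover `C` (`d ≥ 2`, `L ≥ 2`): combine
`card_mul_eq_card_plaquette_of_cover` with `2·#plaquettes = #sites·d(d−1)`. [ours] -/
theorem four_mul_card_eq_of_cover {d L : ℕ} [NeZero L] (hd : 2 ≤ d) (hL : 2 ≤ L)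
    (C : Finset (Edge d L))
    (hC : ∀ p : Plaquette d L, ∃ e ∈ ({(p.1, p.2.1.1), (p.1.shift p.2.1.1, p.2.1.2),
        (p.1.shift p.2.1.2, p.2.1.1), (p.1, p.2.1.2)} : Finset (Edge d L)),
      e ∈ C ∧ ∀ e' ∈ ({(p.1, p.2.1.1), (p.1.shift p.2.1.1, p.2.1.2),
        (p.1.shift p.2.1.2, p.2.1.1), (p.1, p.2.1.2)} : Finset (Edge d L)), e' ≠ e → e' ∉ C) :
    4 * C.card = d * Fintype.card (Site d L) := by
  have h1 := card_mul_eq_card_plaquette_of_cover hd hL C hC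
  have h2 := two_mul_card_plaquette d L
  have h3 : (d - 1) * (4 * C.card) = (d - 1) * (d * Fintype.card (Site d L)) := by
    calc (d - 1) * (4 * C.card) = 2 * (C.card * (2 * (d - 1))) := by ring
      _ = 2 * Fintype.card (Plaquette d L) := by rw [h1]
      _ = (d - 1) * (d * Fintype.card (Site d L)) := by rw [h2]; ring
  exact Nat.eq_of_mul_eq_mul_left (by omega) h3

/-! ## §4 Cover ⇒ sharp order -/

/-- **Cover ⇒ sharp order** (`d ≥ 2`, `L ≥ 2`): an exact plaquette cover `C` gives a duplicate-free list of
all links whose plaquette last links all lie in `C`, with `4·#C = d·#sites` and `#C·2(d−1) = #plaquettes` —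
the lower bound of `exists_lastLinks_all` attained. [ours] -/
theorem exists_sharp_order_of_cover {d L : ℕ} [NeZero L] (hd : 2 ≤ d) (hL : 2 ≤ L)
    (C : Finset (Edge d L))
    (hC : ∀ p : Plaquette d L, ∃ e ∈ ({(p.1, p.2.1.1), (p.1.shift p.2.1.1, p.2.1.2),
        (p.1.shift p.2.1.2, p.2.1.1), (p.1, p.2.1.2)} : Finset (Edge d L)),
      e ∈ C ∧ ∀ e' ∈ ({(p.1, p.2.1.1), (p.1.shift p.2.1.1, p.2.1.2),
        (p.1.shift p.2.1.2, p.2.1.1), (p.1, p.2.1.2)} : Finset (Edge d L)), e' ≠ e → e' ∉ C) :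
    ∃ l : List (Edge d L), l.Nodup ∧ (∀ e : Edge d L, e ∈ l) ∧
      4 * C.card = d * Fintype.card (Site d L) ∧ C.card * (2 * (d - 1)) = Fintype.card (Plaquette d L) ∧
      ∀ p : Plaquette d L, ∃ e ∈ ({(p.1, p.2.1.1), (p.1.shift p.2.1.1, p.2.1.2),
          (p.1.shift p.2.1.2, p.2.1.1), (p.1, p.2.1.2)} : Finset (Edge d L)),
        e ∈ C ∧ ∀ e' ∈ ({(p.1, p.2.1.1), (p.1.shift p.2.1.1, p.2.1.2),
          (p.1.shift p.2.1.2, p.2.1.1), (p.1, p.2.1.2)} : Finset (Edge d L)), e' ≠ e → l.idxOf e' < l.idxOf e := by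
  obtain ⟨l, hnd, hall, hlast⟩ := exists_order_of_plaquetteCover C hC
  exact ⟨l, hnd, hall, four_mul_card_eq_of_cover hd hL C hC,
    card_mul_eq_card_plaquette_of_cover hd hL C hC, hlast⟩

end Summit.Ventures.LatticeQCDFlow.Theory2.Autoregressive
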